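import Literature.NumberTheory.GaloisRepresentations.HeckeCharacterConductor
import Literature.NumberTheory.GaloisRepresentations.HeckeCharacterFiniteIdeleValuesProofs
import HarnessLib

/-!
# The finite character of an algebraic Hecke character modulo its CONDUCTOR is primitive — proofs

Topic `NumberTheory/GaloisRepresentations`; namespace `Literature.NumberTheory.GaloisRepresentations.HeckeCharacter`.  THEOREMS ONLY
(no definition, no named fact, no instance, no `sorry`).  Companion of `HeckeCharacterConductor.lean` (`𝔣(χ) = ∏_v 𝔭_v^{f(χ_v)}`,
Neukirch VII (6.11): «the smallest module of definition») and `GrossencharakterPrimitive.lean` (primitivity phrased through Größencharakter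
DATA: no datum of the same type modulo a proper divisor).  Here primitivity is proved in the CLASSICAL form used by Hecke's functional
equation (Neukirch VII §6 Def. (6.2)–(6.3) and §8 before (8.5): the finite character `χ_f` of a Größencharakter `mod 𝔣(χ)` is a PRIMITIVE
character of `(𝒪/𝔣(χ))^*`): if, for some ideal `𝔪 ⊇ 𝔣(χ)`, the ray relation `χ̃((b)) = ∏_w σ_w(b)^{p_w} σ̄_w(b)^{q_w}` holds for every
nonzero integer `b ≡ 1 mod 𝔪` prime to `𝔣(χ)` — i.e. `χ_f` is trivial on the kernel of `(𝒪/𝔣(χ))^* → (𝒪/𝔪)^*` — then `𝔪 = 𝔣(χ)`.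

Proof (Neukirch VII §6, proof of (6.13), run backwards; the tree's `HasInfinityType.coe_map_localUnits_mem` is the template): for a
ramified `v` and a unit `u ≡ 1 mod 𝔭_v^{ν_v(𝔪)}` of `K_v`, approximate `u` by an algebraic INTEGER `b` (density of `K` in `K_v`,
Mathlib `exists_valuation_sub_lt_of_integer`, and the Chinese remainder theorem) with `b ≡ u mod 𝔭_v^{N}`, `b ≡ 1 mod 𝔭_w^{N}` at the other
ramified `w`, `N` large; then `χ_v(u) = χ_v(b)`, and Neukirch's decomposition of the principal idele `b` (`map_principalIdele_eq`) gives
`χ_v(b) = (χ((b)_∞) · χ̃((b)))⁻¹ = 1` by the hypothesis.  So `χ` is trivial on `U_v^{(ν_v(𝔪))}`, `f(χ_v) ≤ ν_v(𝔪)` for all `v`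
(`conductorExponentAt_le_of_isTrivialOnHigherUnitsAt`), i.e. `𝔪 ⊆ 𝔣(χ)`.  Stated for totally complex `K` (no sign conditions at real
places; the consumer is an imaginary quadratic field) -- TODO(general form): real places (narrow ray, `b ≫ 0` in the approximation).

* `exists_ringOfIntegers_valued_sub_lt` — algebraic integers are dense in `𝒪_v` (to any order `𝔭_v^n`);
* ★ `conductor_eq_of_forall_idealPow_span_eq` — the primitivity statement above.

References: [NeukirchANT1999] Ch. VII §6 Def. (6.1)–(6.3), (6.11), Prop. (6.13); [CasselsFrohlichANT1967] Ch. II §6 (approximation).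
Filed for Hecke's functional equation with conductor (`EllipticCurves/HeckeGrossencharakterFunctionalEquationConductor.lean`, crux L of
`Summits/BirchSwinnertonDyer`); nothing about BSD is proved here.

## Mathlib / tree search
Tree: `isModulus_conductorExponentAt`, `conductorExponentAt_le_of_isTrivialOnHigherUnitsAt`, `mem_toFinset_ramifiedPlaces_iff`
(`HeckeCharacterSharpModulusProofs`); `conductor_le_asIdeal_iff`, `conductor_def` (`HeckeCharacterConductor`); `le_prod_pow_of_forall_le_modulusExp`
(`GrossencharakterConductor`); `mem_of_forall_mem_pow_modulusExp`, `modulusExp_ne_zero_iff` (`HeckeCharacterOfRayClass`); `map_principalIdele_eq`,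
`IsUnramifiedAt.coe_map_localUnits_eq_zpow`, `valued_coe_ringOfIntegers`, `finite_setOf_valuation_coe_ne_one` (`HeckeCharacterDictionary`);
`IsModulus.map_localUnits_eq_one_of_mem`, `HasInfinityType.apply_globalToInfiniteUnits_eq_of_isTotallyComplex` (`HeckeCharacterFiniteIdeleValuesProofs`).
Mathlib: `HeightOneSpectrum.denseRange_algebraMap`, `HeightOneSpectrum.exists_valuation_sub_lt_of_integer`, `IsDedekindDomain.exists_forall_sub_mem_ideal`,
`HeightOneSpectrum.intValuation_le_pow_iff_mem`.  `lean search 'conductor_eq_of_forall|RayPrimitive|isTrivialOnHigherUnitsAt_of'` (2026-09-01): nothing of this kind.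
-/

noncomputable section

open scoped NumberField ComplexConjugate Classical
open NumberField IsDedekindDomain Filter

namespace Literature.NumberTheory.GaloisRepresentations

namespace HeckeCharacter

variable {K : Type} [Field K] [NumberField K]

/-! ### §1 Algebraic integers are dense in `𝒪_v` -/

/-- Congruence balls `{c | |c - c₀|_v < |b|_v}` of `K_v` are open. [cite: CasselsFrohlichANT1967, Ch. II §6] -/
private theorem isOpen_setOf_valued_sub_lt' (v : HeightOneSpectrum (𝓞 K)) (c₀ b : v.adicCompletion K) :
    IsOpen {c : v.adicCompletion K | Valued.v (c - c₀) < Valued.v b} := by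
  have h1 : IsOpen {y : v.adicCompletion K | Valued.v y < Valued.v b} := by
    simpa only [Valuation.restrict_lt_iff] using
      Valued.isOpen_ball (v.adicCompletion K) (Valued.v.restrict b)
  exact h1.preimage (continuous_id.sub continuous_const)

/-- **Algebraic integers are dense in `𝒪_v`**: an element `u` of `K_v` with `|u|_v ≤ 1` is congruent modulo `𝔭_v^n` to (the image of)
an algebraic integer `a ∈ 𝒪_K`, for every `n` (density of `K` in `K_v` and `𝒪_K → 𝒪_K/𝔭^n ≅ 𝒪_v/𝔭_v^n`).
[cite: NeukirchANT1999, Ch. II §3 Prop. (3.3) and §4 (4.3)] -/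
theorem exists_ringOfIntegers_valued_sub_lt (v : HeightOneSpectrum (𝓞 K)) (u : v.adicCompletion K)
    (hu : Valued.v u ≤ 1) (n : ℕ) :
    ∃ a : 𝓞 K, Valued.v (algebraMap K (v.adicCompletion K) (a : K) - u) < WithZero.exp (-(n : ℤ)) := by
  set π : v.adicCompletion K := ((uniformizer K v : (v.adicCompletion K)ˣ) : v.adicCompletion K) with hπ
  have hπn : Valued.v (π ^ n) = WithZero.exp (-(n : ℤ)) := by
    rw [map_pow, hπ, valued_uniformizer, ← WithZero.exp_nsmul]
    congr 1
    simp
  -- a global element `k ∈ K` close to `u`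
  have hmem : {c : v.adicCompletion K | Valued.v (c - u) < Valued.v (π ^ n)} ∈ nhds u := by
    refine (isOpen_setOf_valued_sub_lt' v u (π ^ n)).mem_nhds ?_
    rw [Set.mem_setOf_eq, sub_self, map_zero, hπn]
    exact zero_lt_iff.2 WithZero.exp_ne_zero
  obtain ⟨k, hk⟩ := (HeightOneSpectrum.denseRange_algebraMap K v).mem_nhds hmem
  rw [Set.mem_setOf_eq, hπn] at hk
  have hn1 : WithZero.exp (-(n : ℤ)) ≤ 1 := by
    rw [← WithZero.exp_zero, WithZero.exp_le_exp]; omega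
  -- `k` is a `v`-integer
  have hk1 : v.valuation K k ≤ 1 := by
    rw [← valued_algebraMap_adicCompletion]
    have h := Valuation.map_add Valued.v (algebraMap K (v.adicCompletion K) k - u) u
    rw [sub_add_cancel] at h
    exact h.trans (max_le (hk.le.trans hn1) hu)
  -- an algebraic integer `a` close to `k`
  obtain ⟨a, ha⟩ := v.exists_valuation_sub_lt_of_integer hk1 (Units.mk0 (WithZero.exp (-(n : ℤ))) WithZero.exp_ne_zero)
  rw [Units.val_mk0] at ha
  refine ⟨a, ?_⟩
  have h1 : Valued.v (algebraMap K (v.adicCompletion K) (a : K) - algebraMap K (v.adicCompletion K) k) <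
      WithZero.exp (-(n : ℤ)) := by
    rw [← map_sub, valued_algebraMap_adicCompletion]
    exact ha
  have h := Valuation.map_add_lt Valued.v h1 hk
  rwa [sub_add_sub_cancel] at h

/-! ### §2 Primitivity of `χ_f` modulo the conductor -/

/-- The value of an algebraic integer `r ∈ 𝔭_w^k` in `K_w` has `|r|_w ≤ |ϖ_w|^k`. [cite: NeukirchANT1999, Ch. II §3 Prop. (3.3)] -/
private theorem valued_algebraMap_le_of_mem_pow {w : HeightOneSpectrum (𝓞 K)} {r : 𝓞 K} {k : ℕ} (h : r ∈ w.asIdeal ^ k) :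
    Valued.v (algebraMap K (w.adicCompletion K) (r : K)) ≤ WithZero.exp (-(k : ℤ)) := by
  rw [valued_algebraMap_adicCompletion, show (r : K) = algebraMap (𝓞 K) K r from rfl,
    HeightOneSpectrum.valuation_of_algebraMap]
  exact (HeightOneSpectrum.intValuation_le_pow_iff_mem w r k).mpr h

/-- Conversely `|r|_w ≤ |ϖ_w|^k` gives `r ∈ 𝔭_w^k`. [cite: NeukirchANT1999, Ch. II §3 Prop. (3.3)] -/
private theorem mem_pow_of_valued_algebraMap_le {w : HeightOneSpectrum (𝓞 K)} {r : 𝓞 K} {k : ℕ}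
    (h : Valued.v (algebraMap K (w.adicCompletion K) (r : K)) ≤ WithZero.exp (-(k : ℤ))) : r ∈ w.asIdeal ^ k := by
  rw [valued_algebraMap_adicCompletion, show (r : K) = algebraMap (𝓞 K) K r from rfl,
    HeightOneSpectrum.valuation_of_algebraMap] at h
  exact (HeightOneSpectrum.intValuation_le_pow_iff_mem w r k).mp h

/-- ★ **The finite character of an algebraic Hecke character is PRIMITIVE modulo the conductor** (Neukirch VII §6 (6.11): `𝔣(χ)` is the
smallest module of definition; Def. (6.2)–(6.3)).  Let `K` be totally complex, `χ` of infinity type `(p, q)` with conductor `𝔣 = 𝔣(χ)` and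
ideal character `χ̃ = idealPow (χ(ϖ_·))`.  If `𝔣 ⊆ 𝔪` and the ray relation `χ̃((b)) = ∏_w σ_w(b)^{p_w} σ̄_w(b)^{q_w}` holds for EVERY nonzero
integer `b ≡ 1 mod 𝔪` prime to `𝔣` (not merely for `b ≡ 1 mod 𝔣`), then `𝔪 = 𝔣`.  Proof: such `b` approximate every unit
`u ∈ U_v^{(ν_v(𝔪))}` at a ramified `v` (and `1` at the other ramified places), and the decomposition of the principal idele `b`
(proof of (6.13)) yields `χ_v(u) = 1`; so `f(χ_v) ≤ ν_v(𝔪)` for all `v`.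
[cite: NeukirchANT1999, Ch. VII §6 Def. (6.2), (6.11), Prop. (6.13) (proof)] -/
theorem conductor_eq_of_forall_idealPow_span_eq [IsTotallyComplex K] {χ : HeckeCharacter K} {p q : InfinitePlace K → ℤ}
    (hinf : χ.HasInfinityType p q) {𝔪 : Ideal (𝓞 K)} (hle : χ.conductor ≤ 𝔪)
    (H : ∀ b : 𝓞 K, b ≠ 0 → IsCoprime (Ideal.span {b}) χ.conductor → b - 1 ∈ 𝔪 →
      LFunctions.idealPow K (fun v ↦ (χ.valueAtUniformizer v : ℂ)) (Ideal.span {b}) =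
        ∏ w : InfinitePlace K, w.embedding (b : K) ^ (p w) * conj (w.embedding (b : K)) ^ (q w)) :
    𝔪 = χ.conductor := by
  classical
  set T := (finite_ramifiedPlaces_holds χ).toFinset with hT
  set e : HeightOneSpectrum (𝓞 K) → ℕ := fun w ↦ χ.conductorExponentAt w with he
  have hmod : χ.IsModulus T e := χ.isModulus_conductorExponentAt
  have h𝔣0 : χ.conductor ≠ ⊥ := χ.conductor_ne_bot
  have h𝔪0 : 𝔪 ≠ ⊥ := by
    rintro rfl
    exact h𝔣0 (le_bot_iff.mp hle)
  have hmemT : ∀ w : HeightOneSpectrum (𝓞 K), w ∈ T ↔ χ.conductor ≤ w.asIdeal := fun w ↦ by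
    rw [hT, mem_toFinset_ramifiedPlaces_iff, ← conductor_le_asIdeal_iff]
  have hT𝔪 : ∀ w : HeightOneSpectrum (𝓞 K), 𝔪 ≤ w.asIdeal → w ∈ T := fun w hw ↦ (hmemT w).mpr (hle.trans hw)
  -- it suffices to show that `χ` is trivial on `U_v^{(ν_v(𝔪))}` at every ramified `v`
  suffices hkey : ∀ v ∈ T, χ.IsTrivialOnHigherUnitsAt v (modulusExp 𝔪 v) by
    refine le_antisymm ?_ hle
    rw [conductor_def]
    exact le_prod_pow_of_forall_le_modulusExp h𝔪0 fun v hv ↦ conductorExponentAt_le_of_isTrivialOnHigherUnitsAt (hkey v hv)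
  intro v hv u hu
  set n := modulusExp 𝔪 v with hn
  set U : (v.adicCompletion K)ˣ := Units.map ((v.adicCompletionIntegers K).subtype : _ →* _) u with hU
  have hUval : (U : v.adicCompletion K) = ((u : v.adicCompletionIntegers K) : v.adicCompletion K) := rfl
  have hU1 : Valued.v (U : v.adicCompletion K) = 1 := by
    rw [hUval]
    simpa using HeightOneSpectrum.adicCompletionIntegers.isUnit_iff_valued_eq_one.1 u.isUnit
  have hucong : Valued.v ((U : v.adicCompletion K) - 1) ≤ WithZero.exp (-(n : ℤ)) := by rw [hUval]; exact hu
  rw [localComponent_apply]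
  -- exponents of approximation
  set N : HeightOneSpectrum (𝓞 K) → ℕ := fun w ↦ e w + modulusExp 𝔪 w + 1 with hN
  have hNe : ∀ w, (e w : ℤ) ≤ N w := fun w ↦ by simp only [hN]; push_cast; omega
  have hNm : ∀ w, modulusExp 𝔪 w ≤ N w := fun w ↦ by simp only [hN]; omega
  have hN1 : ∀ w, WithZero.exp (-(N w : ℤ)) < 1 := fun w ↦ by
    rw [← WithZero.exp_zero, WithZero.exp_lt_exp]; simp only [hN]; push_cast; omega
  have hNe' : ∀ w, WithZero.exp (-(N w : ℤ)) ≤ WithZero.exp (-(e w : ℤ)) := fun w ↦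
    WithZero.exp_le_exp.2 (neg_le_neg (hNe w))
  have hNm' : ∀ w, WithZero.exp (-(N w : ℤ)) ≤ WithZero.exp (-(modulusExp 𝔪 w : ℤ)) := fun w ↦
    WithZero.exp_le_exp.2 (neg_le_neg (by exact_mod_cast hNm w))
  -- Step 1: an algebraic integer `a` close to `U` at `v`
  obtain ⟨a, ha⟩ := exists_ringOfIntegers_valued_sub_lt v (U : v.adicCompletion K) hU1.le (N v)
  -- Step 2: Chinese remainder: `b ≡ a mod 𝔭_v^{N_v}`, `b ≡ 1 mod 𝔭_w^{N_w}` at the other ramified `w`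
  obtain ⟨b, hb⟩ := IsDedekindDomain.exists_forall_sub_mem_ideal (s := T) (fun w : HeightOneSpectrum (𝓞 K) ↦ w.asIdeal) N
    (fun w _ ↦ w.prime) (fun w _ w' _ hne h ↦ hne (HeightOneSpectrum.ext h))
    (fun w ↦ if (w : HeightOneSpectrum (𝓞 K)) = v then a else 1)
  have hbv : b - a ∈ v.asIdeal ^ N v := by simpa using hb v hv
  have hbw : ∀ w ∈ T, w ≠ v → b - 1 ∈ w.asIdeal ^ N w := fun w hw hwv ↦ by simpa [hwv] using hb w hw
  -- valuations of `b`
  have hbU : Valued.v (algebraMap K (v.adicCompletion K) (b : K) - (U : v.adicCompletion K)) ≤ WithZero.exp (-(N v : ℤ)) := by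
    have h1 : Valued.v (algebraMap K (v.adicCompletion K) (b : K) - algebraMap K (v.adicCompletion K) (a : K)) ≤
        WithZero.exp (-(N v : ℤ)) := by
      rw [← map_sub, show (b : K) - (a : K) = ((b - a : 𝓞 K) : K) by push_cast; ring]
      exact valued_algebraMap_le_of_mem_pow hbv
    have h := Valuation.map_add Valued.v (algebraMap K (v.adicCompletion K) (b : K) - algebraMap K (v.adicCompletion K) (a : K))
      (algebraMap K (v.adicCompletion K) (a : K) - (U : v.adicCompletion K))
    rw [sub_add_sub_cancel] at h
    exact h.trans (max_le h1 ha.le)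
  have hbval : Valued.v (algebraMap K (v.adicCompletion K) (b : K)) = 1 := by
    rw [← hU1]
    exact Valuation.map_eq_of_sub_lt _ (by rw [hU1]; exact hbU.trans_lt (hN1 v))
  have hb0' : (b : K) ≠ 0 := by
    intro h
    rw [h, map_zero, map_zero] at hbval
    exact zero_ne_one hbval
  have hb0 : b ≠ 0 := fun h ↦ hb0' (by exact_mod_cast h)
  have hbwval : ∀ w ∈ T, w ≠ v → Valued.v (algebraMap K (w.adicCompletion K) (b : K) - 1) ≤ WithZero.exp (-(N w : ℤ)) :=
    fun w hw hwv ↦ by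
      have h := valued_algebraMap_le_of_mem_pow (hbw w hw hwv)
      rwa [show ((b - 1 : 𝓞 K) : K) = (b : K) - 1 by push_cast; ring, map_sub, map_one] at h
  have hbw1 : ∀ w ∈ T, w ≠ v → Valued.v (algebraMap K (w.adicCompletion K) (b : K)) = 1 := fun w hw hwv ↦ by
    have hlt : Valued.v (algebraMap K (w.adicCompletion K) (b : K) - 1) < 1 := (hbwval w hw hwv).trans_lt (hN1 w)
    have h := Valuation.map_eq_of_sub_lt Valued.v (x := (1 : w.adicCompletion K)) (by rw [map_one]; exact hlt)
    rwa [map_one] at h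
  -- `b ≡ 1 mod 𝔪`
  have hb1v : b - 1 ∈ v.asIdeal ^ n := by
    refine mem_pow_of_valued_algebraMap_le ?_
    rw [show ((b - 1 : 𝓞 K) : K) = (b : K) - 1 by push_cast; ring, map_sub, map_one]
    have h := Valuation.map_add Valued.v (algebraMap K (v.adicCompletion K) (b : K) - (U : v.adicCompletion K))
      ((U : v.adicCompletion K) - 1)
    rw [sub_add_sub_cancel] at h
    exact h.trans (max_le (hbU.trans (hNm' v)) hucong)
  have hb1 : b - 1 ∈ 𝔪 := mem_of_forall_mem_pow_modulusExp h𝔪0 fun w hw ↦ by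
    have hwT : w ∈ T := hT𝔪 w ((modulusExp_ne_zero_iff 𝔪 h𝔪0 w).mp hw)
    by_cases hwv : w = v
    · subst hwv; exact hb1v
    · exact Ideal.pow_le_pow_right (hNm w) (hbw w hwT hwv)
  -- `b` is prime to `𝔣`
  have hbT : ∀ w ∈ T, b ∉ w.asIdeal := fun w hw hbw' ↦ by
    have h1 : Valued.v (algebraMap K (w.adicCompletion K) (b : K)) = 1 := by
      by_cases hwv : w = v
      · subst hwv; exact hbval
      · exact hbw1 w hw hwv
    rw [valued_algebraMap_adicCompletion, HeightOneSpectrum.valuation_eq_one_iff_notMem (K := K)] at h1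
    exact h1 hbw'
  have hcop : IsCoprime (Ideal.span {b}) χ.conductor :=
    (LFunctions.isCoprime_iff_forall_not_le h𝔣0).mpr fun w hw hle' ↦
      hbT w ((hmemT w).mpr hw) ((Ideal.span_singleton_le_iff_mem _).mp hle')
  have hH := H b hb0 hcop hb1
  -- Step 3: `χ(⟨U⟩_v) = χ(⟨b⟩_v)`
  set B : Kˣ := Units.mk0 (b : K) hb0' with hB
  have hBval : (B : K) = (b : K) := rfl
  set u' : (v.adicCompletion K)ˣ := globalToLocalUnits v B * U⁻¹ with hu'
  have hu'sub : (u' : v.adicCompletion K) - 1 =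
      (algebraMap K (v.adicCompletion K) (b : K) - (U : v.adicCompletion K)) * (U : v.adicCompletion K)⁻¹ := by
    rw [hu', Units.val_mul, Units.val_inv_eq_inv_val, val_globalToLocalUnits, hBval, sub_mul, mul_inv_cancel₀ U.ne_zero]
  have hu'cong : Valued.v ((u' : v.adicCompletion K) - 1) ≤ WithZero.exp (-(e v : ℤ)) := by
    rw [hu'sub, map_mul, map_inv₀, hU1, inv_one, mul_one]
    exact hbU.trans (hNe' v)
  have hu'1 : Valued.v (u' : v.adicCompletion K) = 1 := by
    rw [hu', Units.val_mul, Units.val_inv_eq_inv_val, map_mul, map_inv₀, hU1, inv_one, mul_one, val_globalToLocalUnits,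
      hBval, hbval]
  have hχu' : χ (localUnits v u') = 1 := hmod.map_localUnits_eq_one_of_mem u' hu'1 hu'cong
  have hUB : χ (localUnits v U) = χ (localUnits v (globalToLocalUnits v B)) := by
    have h1 : globalToLocalUnits v B = u' * U := by rw [hu', inv_mul_cancel_right]
    rw [h1, map_mul, map_mul, hχu', one_mul]
  rw [hUB]
  -- Step 4: Neukirch's decomposition of the principal idele `b`
  set S : Finset (HeightOneSpectrum (𝓞 K)) := T ∪ (finite_setOf_valuation_coe_ne_one (K := K) hb0).toFinset with hS
  have hTS : T ⊆ S := Finset.subset_union_left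
  have hSb : ∀ w ∉ S, w.valuation K (B : K) = 1 := fun w hw ↦ by
    by_contra h
    exact hw (Finset.mem_union_right _ ((Set.Finite.mem_toFinset _).mpr h))
  have hdec := map_principalIdele_eq hmod B hTS hSb
  rw [← Finset.prod_sdiff hTS, ← Finset.mul_prod_erase T _ hv] at hdec
  -- the factors at the other ramified places are `1`
  have hT1 : ∏ w ∈ T.erase v, χ (localUnits w (globalToLocalUnits w B)) = 1 := Finset.prod_eq_one fun w hw ↦ by
    obtain ⟨hwv, hwT⟩ := Finset.mem_erase.mp hw
    refine hmod.map_localUnits_eq_one_of_mem _ ?_ ?_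
    · rw [val_globalToLocalUnits, hBval]; exact hbw1 w hwT hwv
    · rw [val_globalToLocalUnits, hBval]; exact (hbwval w hwT hwv).trans (hNe' w)
  rw [hT1, mul_one] at hdec
  -- the factors off `T` make up `χ̃((b))`
  have hval : ∀ w ∈ S \ T, (χ (localUnits w (globalToLocalUnits w B)) : ℂ) =
      χ.valueAtUniformizer w ^ (Associates.mk w.asIdeal).count (Associates.mk (Ideal.span {b} : Ideal (𝓞 K))).factors := by
    intro w hw
    have hwT : w ∉ T := (Finset.mem_sdiff.mp hw).2
    rw [(isUnramifiedAt_of_isModulus' hmod hwT).coe_map_localUnits_eq_zpow (globalToLocalUnits w B)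
      (m := ((Associates.mk w.asIdeal).count (Associates.mk (Ideal.span {b} : Ideal (𝓞 K))).factors : ℤ))
      (by rw [val_globalToLocalUnits, hBval]; exact valued_coe_ringOfIntegers w hb0), zpow_natCast]
  have hout : (((∏ w ∈ S \ T, χ (localUnits w (globalToLocalUnits w B)) : ℂˣ)) : ℂ) =
      LFunctions.idealPow K (fun v ↦ (χ.valueAtUniformizer v : ℂ)) (Ideal.span {b}) := by
    rw [Units.coe_prod, LFunctions.idealPow, finprod_eq_prod_of_mulSupport_subset _ (s := S \ T) ?_]
    · exact Finset.prod_congr rfl fun w hw ↦ hval w hw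
    · intro w hw
      rw [Function.mem_mulSupport] at hw
      have hcnt : (Associates.mk w.asIdeal).count
          (Associates.mk (Ideal.span {b} : Ideal (𝓞 K))).factors ≠ 0 := fun h0 ↦ hw (by rw [h0, pow_zero])
      have hdvd : w.asIdeal ∣ Ideal.span {b} :=
        (Associates.count_ne_zero_iff_dvd ((Submodule.ne_bot_iff _).mpr
          ⟨b, Ideal.mem_span_singleton_self b, hb0⟩) w.irreducible).mp hcnt
      have hbw' : b ∈ w.asIdeal := Ideal.dvd_span_singleton.mp hdvd
      rw [Finset.coe_sdiff, Set.mem_sdiff, Finset.mem_coe, Finset.mem_coe]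
      refine ⟨?_, fun hwT ↦ hbT w hwT hbw'⟩
      by_contra hwS
      have h1 := hSb w hwS
      rw [hBval, HeightOneSpectrum.valuation_eq_one_iff_notMem (K := K) w] at h1
      exact h1 hbw'
  -- the infinite part is the inverse of `χ̃((b))`
  have hinfB : ((χ (infiniteIdeles K (globalToInfiniteUnits K B)) : ℂˣ) : ℂ) *
      LFunctions.idealPow K (fun v ↦ (χ.valueAtUniformizer v : ℂ)) (Ideal.span {b}) = 1 := by
    rw [hinf.apply_globalToInfiniteUnits_eq_of_isTotallyComplex B, hBval, hH, ← Finset.prod_mul_distrib]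
    refine Finset.prod_eq_one fun w _ ↦ ?_
    have hσ : w.embedding (b : K) ≠ 0 := (map_ne_zero _).mpr hb0'
    have hσ' : conj (w.embedding (b : K)) ≠ 0 := (map_ne_zero _).mpr hσ
    rw [zpow_neg, zpow_neg]
    field_simp
  -- conclude
  have h1 := congrArg Units.val hdec
  rw [Units.val_mul, Units.val_mul, hout, Units.val_one, ← mul_assoc, hinfB, one_mul] at h1
  exact Units.val_eq_one.mp h1

end HeckeCharacter

end Literature.NumberTheory.GaloisRepresentations

end
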